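import Literature.Computability.Cryptography.GapSVPToSIS
import Literature.Algebra.EuclideanLattices.GapCVPPrimeMachine
import Literature.Computability.Complexity.PromiseCookReductionsProofs
import HarnessLib

/-!
# `GapSVP → SIS′` (Micciancio–Regev 2007, Thm. 5.23 with Lemma 5.22): discharges and the one-leaf assembly

Sibling proof file (D-0014, theorems only) of `Literature/Computability/Cryptography/GapSVPToSIS.lean`,
which splits the named fact `Literature.Computability.Cryptography.MicciancioRegev2007_gapSVP_to_SIS'`
(`SIS.lean`; MR07 Thm. 5.23 **with** Lemma 5.22, `GapSVP_γ → SIS′_{q,m,β}`) into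

* `MicciancioRegev2007_gapCVP'_to_SIS'` — Thm. 5.23 proper (`GapCVP′_γ → SIS′`, authors' version p. 28),
* `MicciancioRegev2007_lemma_5_22_promiseBPP'` — Lemma 5.22 in its meaning for probabilistic deciders
  ("By Lemma 5.22 this also implies a reduction from GapSVP_γ to SIS′", p. 28), itself reduced there
  (`MicciancioRegev2007_lemma_5_22_promiseBPP'_of_cook`) to the closure of textbook promise-BPP under
  Cook reductions of promise problems (`PromiseProblem.mem_PromiseBPP'_of_cookReducible`, Goldreich 2006,
  §1.2) and the TM2 running time of the explicit GMSS oracle algorithm (`gmssAlg_isPolyTime`).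

Both of those hypotheses are now theorems of the tree
(`PromiseProblem.mem_PromiseBPP'_of_cookReducible_holds`, `PromiseCookReductionsProofs.lean`;
`gmssAlg_isPolyTime_holds`, `GapCVPPrimeMachine.lean`), so this file records:

* `MicciancioRegev2007_lemma_5_22_promiseBPP'_holds` — **DISCHARGE** of the named fact
  `MicciancioRegev2007_lemma_5_22_promiseBPP'` (MR07 Lemma 5.22 at machine level, no hypothesis left);
* `MicciancioRegev2007_gapSVP_to_SIS'_of_one` — the combined fact from its ONE remaining leaf, Thm. 5.23
  proper: `MicciancioRegev2007_gapCVP'_to_SIS' → MicciancioRegev2007_gapSVP_to_SIS'`.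

So the trust base of `MicciancioRegev2007_gapSVP_to_SIS'` is exactly the printed deep theorem
`GapCVP′_γ → SIS′` (MR07 §5.2–5.4 with the Aharonov–Regev verifier: sampling and combining procedures,
Thm. 5.9 / Cor. 5.13 for the short dual set `S`, Lemma 5.20, and a PPT oracle machine).

## References

* D. Micciancio, O. Regev, *Worst-case to average-case reductions based on Gaussian measures*,
  SIAM J. Comput. 37(1) (2007) 267–302; authors' full version, Lemma 5.22 (p. 27, proof p. 28),
  Thm. 5.23 (p. 28, proof pp. 28–31) [MicciancioRegev2007].
* O. Goldreich, D. Micciancio, S. Safra, J.-P. Seifert, *Approximating shortest lattice vectors is not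
  harder than approximating closest lattice vectors*, IPL 71 (1999), Thm. 1.
* O. Goldreich, *On promise problems: a survey*, LNCS 3895 (2006) 254–290, §1.2, remark after Def. 3.
-/

noncomputable section

namespace Literature.Computability.Cryptography

open Literature.Computability.Complexity Literature.Algebra.EuclideanLattices

/-- **DISCHARGE of `MicciancioRegev2007_lemma_5_22_promiseBPP'`** (Micciancio–Regev 2007, Lemma 5.22 in
its meaning for probabilistic polynomial-time deciders): for every factor `γ` and every set `T` of
dimensions, if `GapCVP′_γ` restricted to dimensions in `T` is in textbook promise-BPP then so is
`GapSVP_γ` restricted to `T`. Proof: the GMSS Cook reduction of promise problems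
(`gapSVP_cookReducible_gapCVP'`, with its running-time fact now the theorem `gmssAlg_isPolyTime_holds`)
and the closure of promise-BPP under Cook reductions (`mem_PromiseBPP'_of_cookReducible_holds`).
[cite: MicciancioRegev2007, Lemma 5.22 (authors' full version p. 27–28)] -/
theorem MicciancioRegev2007_lemma_5_22_promiseBPP'_holds : MicciancioRegev2007_lemma_5_22_promiseBPP' :=
  MicciancioRegev2007_lemma_5_22_promiseBPP'_of_cook
    PromiseProblem.mem_PromiseBPP'_of_cookReducible_holds gmssAlg_isPolyTime_holds

/-- **MR07 Thm. 5.23 with Lemma 5.22 from its one remaining leaf**: Thm. 5.23 proper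
(`GapCVP′_γ → SIS′`, `MicciancioRegev2007_gapCVP'_to_SIS'`) implies the combined named fact
`MicciancioRegev2007_gapSVP_to_SIS'` (`GapSVP_γ → SIS′`) of `SIS.lean`, Lemma 5.22 being discharged
(`MicciancioRegev2007_lemma_5_22_promiseBPP'_holds`). [cite: MicciancioRegev2007, Thm. 5.23 with Lemma 5.22 (authors' full version p. 27–28)] -/
theorem MicciancioRegev2007_gapSVP_to_SIS'_of_one (h : MicciancioRegev2007_gapCVP'_to_SIS') :
    MicciancioRegev2007_gapSVP_to_SIS' :=
  MicciancioRegev2007_gapSVP_to_SIS'_of_gapCVP' h MicciancioRegev2007_lemma_5_22_promiseBPP'_holds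

end Literature.Computability.Cryptography

end
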